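import Literature.RepresentationTheory.HeisenbergGroup.SchrodingerPiOperators
import HarnessLib

/-!
# A functional on `𝒮(F^ι)` invariant under multiplication by `ψ(b·Q)` for an ANISOTROPIC quadratic form `Q` and all `b ∈ F` is supported
# at the origin (non-archimedean local field; model-agnostic kernel lemma)

[MoeglinVignerasWaldspurger1987] C. Mœglin, M.-F. Vignéras, J.-L. Waldspurger, *Correspondances de Howe sur un corps `p`-adique*, LNM 1291 (1987),
Chap. 2 I.3–I.4 (Schrödinger model: the unipotent radical of the Siegel parabolic acts on `𝒮(X)` by multiplication by the second-degree characters
`ψ(½⟨x, c x⟩)`), Chap. 3 §IV (the rank-one theta dichotomy, whose «no invariant functional» half this lemma serves); [WeilBNT1967, Chap. VII §2]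
(Schwartz–Bruhat functions on local fields).  Topic `RepresentationTheory/MoeglinVignerasWaldspurger1987`; namespace
`Literature.RepresentationTheory.MoeglinVignerasWaldspurger1987`.  KERNEL ONLY: one theorem (+ two plumbing lemmas), no definition, no named fact, no
`sorry`.  Cell hodgecm-mathlib, half A line LD2, plate «SOFT-KERNEL» (S1) of LD2-plan (g2) (the soft road to the pin (P) of [Liu2021, Lem. D.1 (1)]: «an
`N_Δ`-invariant functional is supported on the null cone of the anisotropic norm form, i.e. is `c · ev₀`», B-p04 (g44) memo v3 §3); `--supports stmt-HodgeConjecture-24832`.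

THE STATEMENT (`functional_apply_eq_zero_of_forall_unipOpPi_eq`).  `F` a non-archimedean local field (`2` invertible), `ψ : AddChar F Circle` locally constant and
NON-TRIVIAL (`∃ a, ψ a ≠ 1`), `c : F^ι →ₗ F^ι` with the second-degree function `Q = halfForm c : x ↦ ½⟨x, c x⟩` ANISOTROPIC (`Q x = 0 → x = 0`), and `Λ` a
ℂ-linear functional on `𝒮(F^ι)` with `Λ ∘ r(n(b c)) = Λ` for every `b ∈ F` (★ `unipOpPi hl (b • c)` = multiplication by `ψ(-b·Q)`).  THEN `Λ f = 0` for every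
`f ∈ 𝒮(F^ι)` with `f 0 = 0` — so `Λ` factors through evaluation at `0`.

PROOF.  For `x ≠ 0`, `Q x ≠ 0`, so some `b` has `ψ(-b Q x) ≠ 1`; the sets `V_b = {ψ(-bQ) ≠ 1}` are clopen (`ψ ∘ Q` is locally constant) and cover the compact
support of `f` away from the open zero-set of `f`; take finitely many.  Induct on the finite set of `b`'s: split `g = 𝟙_{V_{b₀}} g + 𝟙_{V_{b₀}ᶜ} g`; the
first summand is `(r(n(b₀c)) − 1) h` with `h = 𝟙_{V_{b₀}} g / (ψ(-b₀Q) − 1) ∈ 𝒮` (locally constant, same support), killed by `Λ`; the second is covered by the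
remaining `b`'s.  HONEST LABEL: pure non-archimedean analysis, nothing of [Liu2021] asserted; HC_CM is proved only modulo the 7 printed citations (2 remaining:
hLiu418 = stmt-HodgeConjecture-24832, h413 = stmt-HodgeConjecture-24833) until rung 0 closes; count-neutral.

## References
* [MoeglinVignerasWaldspurger1987] LNM 1291 (1987), Chap. 2 I.3–I.4, II.1; Chap. 3 §IV.
* [WeilBNT1967] A. Weil, *Basic Number Theory* (1967), Chap. VII §2.
* [Rangarao1993] R. Ranga Rao, Pacific J. Math. 157 (1993), Lemma 3.2 (the operators `r(n(c))`).
-/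

set_option autoImplicit false

noncomputable section

namespace Literature.RepresentationTheory.MoeglinVignerasWaldspurger1987

open Literature.RepresentationTheory.HeisenbergGroup
open Literature.NumberTheory.Automorphic
open Literature.NumberTheory.GaloisRepresentations.IsNonarchimedeanLocalField

variable {F : Type*} [Field F] [ValuativeRel F] [TopologicalSpace F] [IsNonarchimedeanLocalField F]
  {ι : Type*} [Fintype ι] [Invertible (2 : F)]
  {ψ : AddChar F Circle} (hl : IsLocallyConstant (⇑ψ : F → Circle))

omit [ValuativeRel F] [TopologicalSpace F] [IsNonarchimedeanLocalField F] in
/-- `½⟨x, (b c) x⟩ = b · ½⟨x, c x⟩`. [cite: Rangarao1993, Lemma 3.2, p. 351] -/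
theorem halfForm_smul (b : F) (c : (ι → F) →ₗ[F] (ι → F)) (x : ι → F) : halfForm (b • c) x = b * halfForm c x := by
  simp only [halfForm, LinearMap.smul_apply, map_smul, smul_eq_mul]
  ring

include hl in
/-- The second-degree character `x ↦ ψ(-½⟨x, (b c) x⟩)` (as a complex-valued function) is locally constant.
[cite: MoeglinVignerasWaldspurger1987, Chap. 2 I.3] -/
theorem isLocallyConstant_psi_halfForm (b : F) (c : (ι → F) →ₗ[F] (ι → F)) :
    IsLocallyConstant fun x : ι → F => ((ψ (-halfForm (b • c) x) : Circle) : ℂ) :=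
  ((hl.comp_continuous (continuous_halfForm (b • c)).neg).comp (fun z : Circle => (z : ℂ)))

/-- **A FUNCTIONAL INVARIANT UNDER ALL `r(n(b c))`, `c` ANISOTROPIC, KILLS EVERY `f` WITH `f 0 = 0`** (it is a multiple of evaluation at `0`).
Hypotheses: `ψ` locally constant with `ψ a ≠ 1` for some `a`; `halfForm c` anisotropic; `Λ (unipOpPi hl (b • c) f) = Λ f` for all `b`, `f`.
[cite: MoeglinVignerasWaldspurger1987, Chap. 2 I.3–I.4; Chap. 3 §IV.4] [cite: WeilBNT1967, Chap. VII §2] -/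
theorem functional_apply_eq_zero_of_forall_unipOpPi_eq (hψ : ∃ a : F, ((ψ a : Circle) : ℂ) ≠ 1)
    (c : (ι → F) →ₗ[F] (ι → F)) (hc : ∀ x : ι → F, halfForm c x = 0 → x = 0)
    (Λ : SchwartzBruhat (ι → F) →ₗ[ℂ] ℂ) (hΛ : ∀ (b : F) (f : SchwartzBruhat (ι → F)), Λ (unipOpPi hl (b • c) f) = Λ f)
    (f : SchwartzBruhat (ι → F)) (hf0 : (f : (ι → F) → ℂ) 0 = 0) : Λ f = 0 := by
  classical
  -- the clopen sets `V b = {ψ(-b Q) ≠ 1}`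
  let V : F → Set (ι → F) := fun b => {x | ((ψ (-halfForm (b • c) x) : Circle) : ℂ) ≠ 1}
  have hVopen : ∀ b, IsOpen (V b) := fun b => isLocallyConstant_psi_halfForm hl b c {z : ℂ | z ≠ 1}
  have hVclosed : ∀ b, IsClosed (V b) := fun b => by
    refine ⟨?_⟩
    have h := isLocallyConstant_psi_halfForm hl b c {(1 : ℂ)}
    convert h using 1
    ext x
    simp [V]
  have hVclopen : ∀ b, IsClopen (V b) := fun b => ⟨hVclosed b, hVopen b⟩
  -- every non-zero vector lies in some `V b` (anisotropy + non-triviality of `ψ`)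
  have hcover : ∀ x : ι → F, x ≠ 0 → ∃ b, x ∈ V b := by
    intro x hx
    obtain ⟨a, ha⟩ := hψ
    have hq : halfForm c x ≠ 0 := fun h => hx (hc x h)
    refine ⟨-(a / halfForm c x), ?_⟩
    show ((ψ (-halfForm ((-(a / halfForm c x)) • c) x) : Circle) : ℂ) ≠ 1
    rwa [halfForm_smul, neg_mul, neg_neg, div_mul_cancel₀ a hq]
  -- the splitting lemma: a Schwartz–Bruhat `g` whose support is covered by `V b`, `b ∈ s`, is killed by `Λ`
  have main : ∀ (s : Finset F) (g : SchwartzBruhat (ι → F)),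
      (∀ x, (g : (ι → F) → ℂ) x ≠ 0 → ∃ b ∈ s, x ∈ V b) → Λ g = 0 := by
    intro s
    induction s using Finset.induction_on with
    | empty =>
      intro g hg
      have h0 : g = 0 := by
        refine Subtype.ext (funext fun x => ?_)
        by_contra h
        obtain ⟨b, hb, -⟩ := hg x h
        simp at hb
      rw [h0, map_zero]
    | insert b₀ s hb₀ ih =>
      intro g hg
      -- `g₁ = 𝟙_{V b₀} g`, `g₂ = 𝟙_{(V b₀)ᶜ} g`
      have hglc : IsLocallyConstant (g : (ι → F) → ℂ) := g.2.1
      have hgcs : HasCompactSupport (g : (ι → F) → ℂ) := g.2.2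
      let g₁ : SchwartzBruhat (ι → F) := ⟨(V b₀).indicator (g : (ι → F) → ℂ),
        (LocallyConstant.indicator ⟨(g : (ι → F) → ℂ), hglc⟩ (hVclopen b₀)).isLocallyConstant,
        hgcs.mono (by rw [Set.support_indicator]; exact Set.inter_subset_right)⟩
      let g₂ : SchwartzBruhat (ι → F) := ⟨(V b₀)ᶜ.indicator (g : (ι → F) → ℂ),
        (LocallyConstant.indicator ⟨(g : (ι → F) → ℂ), hglc⟩ (hVclopen b₀).compl).isLocallyConstant,
        hgcs.mono (by rw [Set.support_indicator]; exact Set.inter_subset_right)⟩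
      have hsplit : g = g₁ + g₂ := Subtype.ext (Set.indicator_self_add_compl (V b₀) (g : (ι → F) → ℂ)).symm
      -- `g₁ = (r(n(b₀ c)) − 1) h` with `h = g₁ / (ψ(-b₀Q) − 1)`
      let hfun : (ι → F) → ℂ := fun x => (V b₀).indicator (g : (ι → F) → ℂ) x / (((ψ (-halfForm (b₀ • c) x) : Circle) : ℂ) - 1)
      have hhlc : IsLocallyConstant hfun :=
        (LocallyConstant.indicator ⟨(g : (ι → F) → ℂ), hglc⟩ (hVclopen b₀)).isLocallyConstant.div
          ((isLocallyConstant_psi_halfForm hl b₀ c).comp fun z : ℂ => z - 1)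
      have hhcs : HasCompactSupport hfun := by
        refine hgcs.mono ?_
        intro x hx
        rw [Function.mem_support] at hx ⊢
        contrapose! hx
        simp only [hfun, Set.indicator_apply_eq_zero.2 (fun _ => hx), zero_div]
      let h : SchwartzBruhat (ι → F) := ⟨hfun, hhlc, hhcs⟩
      have hAh : unipOpPi hl (b₀ • c) h - h = g₁ := by
        refine Subtype.ext (funext fun x => ?_)
        rw [AddSubgroupClass.coe_sub, Pi.sub_apply, coe_unipOpPi_apply]
        change ((ψ (-halfForm (b₀ • c) x) : Circle) : ℂ) * hfun x - hfun x = (V b₀).indicator (g : (ι → F) → ℂ) x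
        by_cases hx : x ∈ V b₀
        · have hne : (((ψ (-halfForm (b₀ • c) x) : Circle) : ℂ) - 1) ≠ 0 := sub_ne_zero.2 hx
          simp only [hfun]
          rw [← sub_one_mul, mul_div_cancel₀ _ hne]
        · simp only [hfun, Set.indicator_of_notMem hx, zero_div, mul_zero, sub_zero]
      have hΛ₁ : Λ g₁ = 0 := by
        rw [← hAh, map_sub, hΛ, sub_self]
      -- `g₂` is covered by the remaining `b`'s
      have hΛ₂ : Λ g₂ = 0 := by
        refine ih g₂ fun x hx => ?_
        have hx' : x ∉ V b₀ ∧ (g : (ι → F) → ℂ) x ≠ 0 := by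
          by_cases hxV : x ∈ V b₀
          · exact absurd (by simp [g₂, Set.indicator_of_notMem (show x ∉ (V b₀)ᶜ from fun h => h hxV)]) hx
          · exact ⟨hxV, by simpa [g₂, Set.indicator_of_mem (show x ∈ (V b₀)ᶜ from hxV)] using hx⟩
        obtain ⟨b, hb, hxb⟩ := hg x hx'.2
        rcases Finset.mem_insert.1 hb with rfl | hb'
        · exact absurd hxb hx'.1
        · exact ⟨b, hb', hxb⟩
      rw [hsplit, map_add, hΛ₁, hΛ₂, add_zero]
  -- a finite set of `b`'s covering the support of `f` (compactness; the zero set of `f` is open)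
  have hflc : IsLocallyConstant (f : (ι → F) → ℂ) := f.2.1
  have hfcs : HasCompactSupport (f : (ι → F) → ℂ) := f.2.2
  have hU0 : IsOpen {x : ι → F | (f : (ι → F) → ℂ) x = 0} := hflc {(0 : ℂ)}
  obtain ⟨t, ht⟩ := hfcs.elim_finite_subcover (fun b : F => V b ∪ {x | (f : (ι → F) → ℂ) x = 0})
    (fun b => (hVopen b).union hU0) (by
      intro x _
      by_cases hx0 : (f : (ι → F) → ℂ) x = 0
      · obtain ⟨a, _⟩ := hψ
        exact Set.mem_iUnion.2 ⟨a, Or.inr hx0⟩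
      · have hxne : x ≠ 0 := fun h => hx0 (h ▸ hf0)
        obtain ⟨b, hb⟩ := hcover x hxne
        exact Set.mem_iUnion.2 ⟨b, Or.inl hb⟩)
  refine main t f fun x hx => ?_
  have hxK : x ∈ tsupport (f : (ι → F) → ℂ) := subset_tsupport _ (Function.mem_support.2 hx)
  obtain ⟨b, hb, hxb⟩ := Set.mem_iUnion₂.1 (ht hxK)
  rcases hxb with hxb | hxb
  · exact ⟨b, hb, hxb⟩
  · exact absurd hxb hx

end Literature.RepresentationTheory.MoeglinVignerasWaldspurger1987

end
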